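import Mathlib
import HarnessLib
import Summits.HubbardSuperconductivity.HubbardSuperconductivity.Theorems.KLProgrammeH10TwoPointLimitKlAnisoCentreTransfer

/-!
# Route `KLProgramme` — K3 engine (stmt-HubbardSuperconductivity-20437), stub (b) (ℓ)/(I2), located item «ON-CLASS-KB» (K): bricks for the
# tight-bundle count (`…KlAnisoTightBundleCount`)

Cell gate-hubbard-kl, seat p4 g13.  Elementary bricks, all PROVED, no definitions, no named facts:
* `torusDist_le_of_polar_close` — two polar points with radii `≥ u_min > 0` that are `ε`-close coordinatewise have torus-angle distance `d` with
  `u_min·d ≤ π·ε` (via Jordan `2δ² ≤ π²(1 − cos δ)` and `|p − p′|² = (u−u′)² + 2uu′(1 − cos d)`);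
* `card_sectors_torusDist_le` — the sectors of scale `n` whose centre is within `D` of a given angle number `≤ 2(2D)/w_n + 2`;
* `signed_eq_halfTurn` — for a centrally symmetric centre map `P` the signed centre point of a leg is `P` at the half-turned index's centre.
Nothing here asserts anything about the model or superconductivity. [folklore]
-/

noncomputable section

namespace Summit.HubbardSuperconductivity.HubbardSuperconductivity.Theorems.PerturbedFermiCurve

set_option linter.dupNamespace false -- summit = problem name (single-conjunct summit), D-0017

open Classical
open Real Set Finset
open Literature.MathematicalPhysics.QuantumLattice Literature.MathematicalPhysics.QuantumLattice.BandSectorCounting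
open Literature.MathematicalPhysics.QuantumLattice.FermiRG Literature.MathematicalPhysics.QuantumLattice.FermiRG.BGM2003

/-! ## §1 Two polar points that are close have close angles -/

/-- Jordan: `2δ² ≤ π²(1 − cos δ)` on `[0, π]`. [folklore] -/
theorem two_mul_sq_le_pi_sq_mul_one_sub_cos' {δ : ℝ} (h0 : 0 ≤ δ) (hπ : δ ≤ π) : 2 * δ ^ 2 ≤ π ^ 2 * (1 - Real.cos δ) := by
  have h1 : 1 - Real.cos δ = 2 * Real.sin (δ / 2) ^ 2 := by
    rw [Real.sin_sq_eq_half_sub, mul_div_cancel₀ δ two_ne_zero]; ring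
  have hj : 2 / π * (δ / 2) ≤ Real.sin (δ / 2) := Real.mul_le_sin (by positivity) (by linarith)
  have hj' : δ / π ≤ Real.sin (δ / 2) := by rwa [show 2 / π * (δ / 2) = δ / π by ring] at hj
  have h3 : (δ / π) ^ 2 ≤ Real.sin (δ / 2) ^ 2 := pow_le_pow_left₀ (by positivity) hj' 2
  have h4 : π ^ 2 * (δ / π) ^ 2 = δ ^ 2 := by field_simp
  have h5 := mul_le_mul_of_nonneg_left h3 (sq_nonneg π)
  rw [h4] at h5; rw [h1]; linarith

/-- `cos θ = cos ‖θ‖_{𝕋¹}`. [folklore] -/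
theorem cos_eq_cos_torusDist (x : ℝ) : Real.cos x = Real.cos (FermiRG.torusDist x) := by
  obtain ⟨q, hq⟩ := exists_torusDist_eq_abs x
  rw [hq, Real.cos_abs, Real.cos_add_int_mul_two_pi]

/-- `‖θ‖_{𝕋¹} ≤ π`. [folklore] -/
theorem torusDist_le_pi_self (x : ℝ) : FermiRG.torusDist x ≤ π := by
  have h := AddCircle.norm_le_half_period (2 * π) (x := ((x : ℝ) : AddCircle (2 * π))) two_pi_pos.ne'
  rw [abs_of_pos two_pi_pos] at h
  unfold FermiRG.torusDist
  linarith

/-- `0 ≤ ‖θ‖_{𝕋¹}`. [folklore] -/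
theorem torusDist_nonneg_self (x : ℝ) : 0 ≤ FermiRG.torusDist x := norm_nonneg _

/-- **Two polar points with radii `≥ u_min > 0` that are `ε`-close coordinatewise have close angles**:
`u_min · ‖θ − θ′‖_{𝕋¹} ≤ π·ε` (from `|u e⃗(θ) − u′ e⃗(θ′)|² ≥ 2uu′(1 − cos(θ−θ′)) ≥ 4u_min²δ²/π²` and the two coordinate bounds `≤ ε` each,
`|·|² ≤ 2ε²`; so `4u_min²δ² ≤ 2π²ε²`, `δ ≤ πε/(√2 u_min) ≤ πε/u_min`). [folklore] -/
theorem torusDist_le_of_polar_close {u u' umin θ θ' ε : ℝ} (humin : 0 < umin) (hu : umin ≤ u) (hu' : umin ≤ u')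
    (h0 : |u * Real.cos θ - u' * Real.cos θ'| ≤ ε) (h1 : |u * Real.sin θ - u' * Real.sin θ'| ≤ ε) :
    umin * FermiRG.torusDist (θ - θ') ≤ π * ε := by
  have hε : 0 ≤ ε := (abs_nonneg _).trans h0
  set d := FermiRG.torusDist (θ - θ') with hd
  have hd0 : 0 ≤ d := torusDist_nonneg_self _
  have hdπ : d ≤ π := torusDist_le_pi_self _
  have hcos : Real.cos (θ - θ') = Real.cos d := cos_eq_cos_torusDist _
  -- the squared distance
  have hS : (u * Real.cos θ - u' * Real.cos θ') ^ 2 + (u * Real.sin θ - u' * Real.sin θ') ^ 2 =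
      (u - u') ^ 2 + 2 * u * u' * (1 - Real.cos d) := by
    rw [← hcos, Real.cos_sub]
    linear_combination (u ^ 2) * Real.sin_sq_add_cos_sq θ + (u' ^ 2) * Real.sin_sq_add_cos_sq θ'
  have hS2 : (u * Real.cos θ - u' * Real.cos θ') ^ 2 + (u * Real.sin θ - u' * Real.sin θ') ^ 2 ≤ 2 * ε ^ 2 := by
    have a0 := sq_le_sq' (abs_le.1 h0).1 (abs_le.1 h0).2
    have a1 := sq_le_sq' (abs_le.1 h1).1 (abs_le.1 h1).2
    linarith
  have hJ := two_mul_sq_le_pi_sq_mul_one_sub_cos' hd0 hdπ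
  have h1c : 0 ≤ 1 - Real.cos d := by linarith [Real.cos_le_one d]
  have huu : umin * umin ≤ u * u' := mul_le_mul hu hu' humin.le (humin.le.trans hu)
  -- `4 umin² d² ≤ π² · 2uu′(1−cos d) · 2 ≤ 2π² ε²`
  have hmain : 2 * (umin * d) ^ 2 ≤ (π * ε) ^ 2 := by
    have h2 : 2 * umin * umin * (1 - Real.cos d) ≤ 2 * u * u' * (1 - Real.cos d) := by nlinarith
    nlinarith [sq_nonneg (u - u'), hJ, h2, mul_nonneg (mul_nonneg (by norm_num : (0:ℝ) ≤ 2) (sq_nonneg umin)) h1c]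
  have hpos : 0 ≤ π * ε := by positivity
  have hpos2 : 0 ≤ umin * d := by positivity
  nlinarith [hmain, hpos, hpos2, sq_nonneg (π * ε - umin * d)]

/-! ## §2 Sectors near a given direction -/

/-- **Sectors whose centre is within `D` of a given angle on the torus number `≤ 2D/w_n + 2`**: two such centres differ by an integer multiple
of `w_n` that is within `2D` on the torus, so the indices lie in an arithmetic window of length `≤ 2D/w_n + 1` up to the wrap. We prove the cruder
but sufficient bound via an injection of the index differences. [folklore] -/
theorem card_sectors_torusDist_le (n : ℕ) (θ₀ D : ℝ) (hD : 0 ≤ D) (b₀ : Fin (sectorCount n))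
    (h₀ : FermiRG.torusDist (sectorCenter n b₀ - θ₀) ≤ D) :
    (((univ : Finset (Fin (sectorCount n))).filter fun b : Fin (sectorCount n) => FermiRG.torusDist (sectorCenter n b - θ₀) ≤ D).card : ℝ) ≤
      2 * (2 * D) / sectorWidth n + 2 := by
  have hw := sectorWidth_pos n
  have hNw := sectorCount_mul_sectorWidth n
  have hN : 0 < sectorCount n := sectorCount_pos n
  set S := (univ : Finset (Fin (sectorCount n))).filter fun b : Fin (sectorCount n) => FermiRG.torusDist (sectorCenter n b - θ₀) ≤ D with hS
  -- every member is within `2D` of `b₀` on the torus, hence its index difference `j = b − b₀` satisfies `‖j w‖_{𝕋¹} ≤ 2D`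
  -- represent `‖j w‖_{𝕋¹} = |j w + q 2π| = |(j + q N) w|`: the integer `z = j + qN` has `|z| w ≤ 2D`; the map `b ↦ z mod N`-free: `b ≡ b₀ + z`.
  have hmem : ∀ b ∈ S, ∃ z : ℤ, |(z : ℝ)| * sectorWidth n ≤ 2 * D ∧ (sectorCount n : ℤ) ∣ ((b : ℤ) - b₀ - z) := by
    intro b hb
    rw [hS, mem_filter] at hb
    have hbb : FermiRG.torusDist (sectorCenter n b - sectorCenter n b₀) ≤ 2 * D := by
      have := torusDist_add_le_add (sectorCenter n b - θ₀) (-(sectorCenter n b₀ - θ₀))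
      rw [torusDist_neg_eq] at this
      rw [show sectorCenter n b - sectorCenter n b₀ = sectorCenter n b - θ₀ + -(sectorCenter n b₀ - θ₀) by ring]
      linarith [hb.2]
    obtain ⟨q, hq⟩ := exists_torusDist_eq_abs (sectorCenter n b - sectorCenter n b₀)
    refine ⟨((b : ℕ) : ℤ) - b₀ + q * sectorCount n, ?_, ⟨-q, by ring⟩⟩
    have e : sectorCenter n b - sectorCenter n b₀ + q * (2 * π) = ((((b : ℕ) : ℤ) - b₀ + q * sectorCount n : ℤ) : ℝ) * sectorWidth n := by
      rw [BandSectorCounting.sectorCenter_eq, BandSectorCounting.sectorCenter_eq, ← hNw]; push_cast; ring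
    rw [hq, e, abs_mul, abs_of_pos hw] at hbb
    exact hbb
  choose! z hz using hmem
  -- injection `b ↦ z b` into the integers of modulus `≤ 2D/w`
  have hinj : Set.InjOn z S := by
    intro b hb b' hb' hzz
    have h1 := (hz b (Finset.mem_coe.1 hb)).2
    have h2 := (hz b' (Finset.mem_coe.1 hb')).2
    rw [hzz] at h1
    have h3 : (sectorCount n : ℤ) ∣ ((b : ℤ) - b') := by
      have := dvd_sub h1 h2
      have e : (b : ℤ) - ↑↑b₀ - z b' - ((b' : ℤ) - ↑↑b₀ - z b') = (b : ℤ) - b' := by ring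
      rwa [e] at this
    have hb1 := b.isLt; have hb2 := b'.isLt
    apply Fin.ext
    rcases h3 with ⟨t, ht⟩
    have : t = 0 := by
      by_contra hne
      rcases lt_or_gt_of_ne hne with hlt | hgt
      · have : (t : ℤ) ≤ -1 := by omega
        nlinarith
      · have : (1 : ℤ) ≤ t := by omega
        nlinarith
    rw [this, mul_zero, sub_eq_zero] at ht
    exact_mod_cast ht
  set M : ℕ := Nat.floor (2 * D / sectorWidth n) with hM
  have hzrange : ∀ b ∈ S, z b ∈ Finset.Icc (-(M : ℤ)) M := by
    intro b hb
    have h1 := (hz b hb).1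
    have h2 : |(z b : ℝ)| ≤ 2 * D / sectorWidth n := by rw [le_div_iff₀ hw]; exact h1
    have h3 : |(z b : ℝ)| < M + 1 := h2.trans_lt (Nat.lt_floor_add_one _)
    have h4 : |z b| ≤ M := by
      have h5 : ((|z b| : ℤ) : ℝ) < (M : ℝ) + 1 := by rw [Int.cast_abs]; exact h3
      have h6 : (|z b| : ℤ) < (M : ℤ) + 1 := by exact_mod_cast h5
      omega
    rw [Finset.mem_Icc]; exact abs_le.1 h4
  have hcard : S.card ≤ (Finset.Icc (-(M : ℤ)) M).card := Finset.card_le_card_of_injOn z hzrange hinj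
  rw [Int.card_Icc] at hcard
  have hM' : (M : ℝ) ≤ 2 * D / sectorWidth n := Nat.floor_le (by positivity)
  have : (S.card : ℝ) ≤ ((M : ℤ) + 1 - -(M : ℤ)).toNat := by exact_mod_cast hcard
  have e : (((M : ℤ) + 1 - -(M : ℤ)).toNat : ℝ) = 2 * M + 1 := by
    have : (M : ℤ) + 1 - -(M : ℤ) = ((2 * M + 1 : ℕ) : ℤ) := by push_cast; ring
    rw [this, Int.toNat_natCast]; push_cast; ring
  rw [e] at this
  have e2 : 2 * (2 * D) / sectorWidth n = 2 * (2 * D / sectorWidth n) := by ring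
  rw [e2]
  linarith


/-! ## §3 Sign absorption by the half-turn -/

/-- Half-turn on the index = antipode on the curve: for a centrally symmetric centre map `P` (`P(θ+π) = −P θ`), the signed centre point of a leg
(`+P` for charge `0`, `−P` otherwise) is `P` at the centre of the half-turned index. [folklore] -/
theorem signed_eq_halfTurn (P : ℝ → (Fin 2 → ℝ)) (hanti : ∀ θ, P (θ + π) = -P θ) (k : ℕ) (c : Fin 2) (j0 : ℕ) :
    (if c = 0 then P (sectorCenter k j0) else -P (sectorCenter k j0)) =
      P (sectorCenter k (if c = 0 then j0 else if j0 < 2 ^ k then j0 + 2 ^ k else j0 - 2 ^ k)) := by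
  have hNw := sectorCount_mul_sectorWidth k
  have hπk : (2 : ℝ) ^ k * sectorWidth k = π := by
    have : (sectorCount k : ℝ) = 2 * 2 ^ k := by unfold sectorCount; push_cast; ring
    rw [this] at hNw; linarith
  by_cases hc : c = 0
  · simp [hc]
  · rw [if_neg hc, if_neg hc]
    by_cases hlt : j0 < 2 ^ k
    · rw [if_pos hlt]
      have e : sectorCenter k (j0 + 2 ^ k) = sectorCenter k j0 + π := by
        rw [BandSectorCounting.sectorCenter_eq, BandSectorCounting.sectorCenter_eq]; push_cast; linear_combination hπk
      rw [e, hanti]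
    · rw [if_neg hlt]
      have hle : 2 ^ k ≤ j0 := not_lt.1 hlt
      have e : sectorCenter k j0 = sectorCenter k (j0 - 2 ^ k) + π := by
        rw [BandSectorCounting.sectorCenter_eq, BandSectorCounting.sectorCenter_eq]; push_cast [Nat.cast_sub hle]; linear_combination hπk
      rw [e, hanti, neg_neg]

end Summit.HubbardSuperconductivity.HubbardSuperconductivity.Theorems.PerturbedFermiCurve
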